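import Mathlib
import Summits.Ventures.HodgeRepro2.T5RamifiedBreak

/-!
# Valuation estimates at a wild ramified place: the trace, the norm, and KEY LEMMA 1 (T5RamifiedNormEstimates)

Setting as T5RamifiedBreak: `K_v ⊆ L_w` ramified quadratic, `π`, `σ ≠ 1`, `v(σ π − π) = exp(−i)`, `v(2) = exp(−e)`,
`i ≤ 2e + 1`; `t = i − 1` the break.

* PARITY helpers: `v(alg a) ≤ exp(−2n) ⇔ v(a) ≤ exp(−n)`; `v(alg a) ≤ exp(−(2n+1)) ⇒ ≤ exp(−(2n+2))`.
* THE TRACE ESTIMATE: `v(x) ≤ exp(−m)` ⇒ `v(x + σ x) ≤ exp(−m − t)` (`Tr x = 2x + (σ x − x)`); `v(x σ x) = v(x)²`.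
* KEY LEMMA 3: `v(x) ≤ exp(−(t+1))` ⇒ `N(1 + x) ∈ U_F^{(t+1)}`.
* KEY LEMMA 1 (wild, `t ≥ 1`): a unit `Y` of `L_w` with `N(Y) ∈ U_F^{(t)}` lies in `U_E^{(t)}` — level `0 → 1` through the
  integral basis and `a² ≡ 1 ⇒ a ≡ 1 (mod 𝔪)` when `v(2) < 1`; level `m → m + 1` (`1 ≤ m < t`) because
  `v(N(1 + x) − 1) = v(x)² = exp(−2m)` exactly when `v(x) = exp(−m)` (Serre, Local Fields V §3 Prop. 5 (i)).
The sequel T5RamifiedNormBelow turns this into `U_F^{(t)} ⊄ N(L_w^×)`.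
-/

namespace Summit.Ventures.HodgeRepro2.T5RamifiedNormEstimates

open IsDedekindDomain HeightOneSpectrum
open Summit.Ventures.HodgeRepro2.T5RamifiedIntegralBasis Summit.Ventures.HodgeRepro2.T5RamifiedBreak
open Summit.Ventures.HodgeRepro2.T5NormCharConductor

variable {K : Type*} [Field K] [NumberField K] (v : HeightOneSpectrum (NumberField.RingOfIntegers K))
  {L : Type*} [Field L] [NumberField L] [Algebra K L] (w : HeightOneSpectrum (NumberField.RingOfIntegers L))
  [w.asIdeal.LiesOver v.asIdeal]
  [ContinuousSMul (v.adicCompletion K) (w.adicCompletion L)]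

noncomputable section

/-! ### Parity helpers: values of `K_v` seen in `L_w` -/

/-- `v(alg a) ≤ exp(−2n)` ⇒ `v(a) ≤ exp(−n)`. -/
theorem val_le_of_val_algebraMap_le (h2 : Module.finrank (v.adicCompletion K) (w.adicCompletion L) = 2)
    {ϖ : v.adicCompletionIntegers K} (hϖ : Irreducible ϖ) {π : w.adicCompletionIntegers L} (hπ : Irreducible π)
    (hram : ¬ Irreducible (algebraMap (v.adicCompletionIntegers K) (w.adicCompletionIntegers L) ϖ))
    {a : v.adicCompletion K} {n : ℤ}
    (h : Valued.v (algebraMap (v.adicCompletion K) (w.adicCompletion L) a) ≤ WithZero.exp (-(2 * n))) :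
    Valued.v a ≤ WithZero.exp (-n) := by
  by_cases ha : a = 0
  · subst ha
    simp
  have h0 : Valued.v a ≠ 0 := (Valuation.ne_zero_iff _).mpr ha
  rw [val_algebraMap_eq_exp_two_mul_log v w h2 hϖ hπ hram ha, WithZero.exp_le_exp] at h
  rw [← WithZero.exp_log h0, WithZero.exp_le_exp]
  omega

/-- `v(a) ≤ exp(−n)` ⇒ `v(alg a) ≤ exp(−2n)`. -/
theorem val_algebraMap_le_of_val_le (h2 : Module.finrank (v.adicCompletion K) (w.adicCompletion L) = 2)
    {ϖ : v.adicCompletionIntegers K} (hϖ : Irreducible ϖ) {π : w.adicCompletionIntegers L} (hπ : Irreducible π)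
    (hram : ¬ Irreducible (algebraMap (v.adicCompletionIntegers K) (w.adicCompletionIntegers L) ϖ))
    {a : v.adicCompletion K} {n : ℤ} (h : Valued.v a ≤ WithZero.exp (-n)) :
    Valued.v (algebraMap (v.adicCompletion K) (w.adicCompletion L) a) ≤ WithZero.exp (-(2 * n)) := by
  rw [T5RamifiedNormTransfer.val_algebraMap_eq_sq v w h2 hϖ hπ hram, sq]
  calc Valued.v a * Valued.v a ≤ WithZero.exp (-n) * WithZero.exp (-n) := mul_le_mul' h h
    _ = WithZero.exp (-(2 * n)) := by
        rw [← WithZero.exp_add]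
        congr 1
        ring

/-- PARITY: `v(alg a) ≤ exp(−(2n + 1))` ⇒ `v(alg a) ≤ exp(−(2n + 2))`. -/
theorem val_algebraMap_le_of_le_odd (h2 : Module.finrank (v.adicCompletion K) (w.adicCompletion L) = 2)
    {ϖ : v.adicCompletionIntegers K} (hϖ : Irreducible ϖ) {π : w.adicCompletionIntegers L} (hπ : Irreducible π)
    (hram : ¬ Irreducible (algebraMap (v.adicCompletionIntegers K) (w.adicCompletionIntegers L) ϖ))
    {a : v.adicCompletion K} {n : ℤ}
    (h : Valued.v (algebraMap (v.adicCompletion K) (w.adicCompletion L) a) ≤ WithZero.exp (-(2 * n + 1))) :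
    Valued.v (algebraMap (v.adicCompletion K) (w.adicCompletion L) a) ≤ WithZero.exp (-(2 * n + 2)) := by
  by_cases ha : a = 0
  · subst ha
    simp
  rw [val_algebraMap_eq_exp_two_mul_log v w h2 hϖ hπ hram ha, WithZero.exp_le_exp] at h ⊢
  omega

/-- `v(alg a) = 1` ⇒ `v(a) = 1`. -/
theorem val_eq_one_of_val_algebraMap_eq_one {a : v.adicCompletion K}
    (h : Valued.v (algebraMap (v.adicCompletion K) (w.adicCompletion L) a) = 1) : Valued.v a = 1 :=
  (T5ContinuousValuationExtension.val_algebraMap_eq_one_iff a).mp h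

/-! ### Trace and norm estimates -/

/-- `v(2 x) ≤ exp(−2e) · v(x)` in `L_w`. -/
theorem val_two_mul_le (h2 : Module.finrank (v.adicCompletion K) (w.adicCompletion L) = 2)
    {ϖ : v.adicCompletionIntegers K} (hϖ : Irreducible ϖ) {π : w.adicCompletionIntegers L} (hπ : Irreducible π)
    (hram : ¬ Irreducible (algebraMap (v.adicCompletionIntegers K) (w.adicCompletionIntegers L) ϖ))
    (e : ℕ) (he : Valued.v (2 : v.adicCompletion K) = WithZero.exp (-(e : ℤ))) (x : w.adicCompletion L) :
    Valued.v ((2 : w.adicCompletion L) * x) = WithZero.exp (-(2 * e : ℤ)) * Valued.v x := by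
  have h2alg : (2 : w.adicCompletion L) = algebraMap (v.adicCompletion K) (w.adicCompletion L) 2 := by
    rw [map_ofNat]
  rw [map_mul, h2alg, T5RamifiedNormTransfer.val_algebraMap_eq_sq v w h2 hϖ hπ hram, he, ← WithZero.exp_nsmul]
  congr 2
  rw [nsmul_eq_mul]
  push_cast
  ring

omit [ContinuousSMul (v.adicCompletion K) (w.adicCompletion L)] in
/-- `N(1 + x) = 1 + (x + σ x) + x σ x`. -/
theorem one_add_mul_algEquiv_one_add (σ : (w.adicCompletion L) ≃ₐ[v.adicCompletion K] (w.adicCompletion L))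
    (x : w.adicCompletion L) : (1 + x) * σ (1 + x) = 1 + ((x + σ x) + x * σ x) := by
  rw [map_add, map_one]
  ring

/-- THE TRACE ESTIMATE: `v(x) ≤ exp(−m)` ⇒ `v(x + σ x) ≤ exp(−m − t)` (`t = i − 1 ≤ 2e`). -/
theorem val_add_algEquiv_le (h2 : Module.finrank (v.adicCompletion K) (w.adicCompletion L) = 2)
    {ϖ : v.adicCompletionIntegers K} (hϖ : Irreducible ϖ) {π : w.adicCompletionIntegers L} (hπ : Irreducible π)
    (hram : ¬ Irreducible (algebraMap (v.adicCompletionIntegers K) (w.adicCompletionIntegers L) ϖ))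
    (σ : (w.adicCompletion L) ≃ₐ[v.adicCompletion K] (w.adicCompletion L))
    {i : ℕ} (hi : Valued.v (σ (π : w.adicCompletion L) - π) = WithZero.exp (-(i : ℤ)))
    (e : ℕ) (he : Valued.v (2 : v.adicCompletion K) = WithZero.exp (-(e : ℤ))) (hie : i ≤ 2 * e + 1)
    (x : w.adicCompletion L) (m : ℤ) (hx : Valued.v x ≤ WithZero.exp (-m)) :
    Valued.v (x + σ x) ≤ WithZero.exp (-m - ((i : ℤ) - 1)) := by
  have hsplit : x + σ x = 2 * x + (σ x - x) := by ring
  rw [hsplit]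
  refine le_trans (Valuation.map_add _ _ _) (max_le ?_ ?_)
  · rw [val_two_mul_le v w h2 hϖ hπ hram e he]
    calc WithZero.exp (-(2 * e : ℤ)) * Valued.v x ≤ WithZero.exp (-(2 * e : ℤ)) * WithZero.exp (-m) := by
          gcongr
      _ = WithZero.exp (-(2 * e : ℤ) + -m) := (WithZero.exp_add _ _).symm
      _ ≤ WithZero.exp (-m - ((i : ℤ) - 1)) := WithZero.exp_le_exp.mpr (by omega)
  · calc Valued.v (σ x - x) ≤ WithZero.exp (1 - m) * Valued.v (σ (π : w.adicCompletion L) - π) :=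
          val_algEquiv_sub_le v w h2 hϖ hπ hram σ x m hx
      _ = WithZero.exp (-m - ((i : ℤ) - 1)) := by
          rw [hi, ← WithZero.exp_add]
          congr 1
          ring

section Estimates

variable [IsScalarTower K (v.adicCompletion K) (w.adicCompletion L)]

/-- `v(x σ x) = v(x)²`. -/
theorem val_mul_algEquiv (σ : (w.adicCompletion L) ≃ₐ[v.adicCompletion K] (w.adicCompletion L))
    (x : w.adicCompletion L) : Valued.v (x * σ x) = Valued.v x ^ 2 := by
  rw [map_mul, T5AdicCompletionGaloisInvariance.val_algEquiv_apply, sq]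

/-- KEY LEMMA 3: `v(x) ≤ exp(−(t+1))` ⇒ the norm `u = N(1 + x) ∈ K_v` has `v(u − 1) ≤ exp(−(t+1))`. -/
theorem val_norm_sub_one_le (h2 : Module.finrank (v.adicCompletion K) (w.adicCompletion L) = 2)
    {ϖ : v.adicCompletionIntegers K} (hϖ : Irreducible ϖ) {π : w.adicCompletionIntegers L} (hπ : Irreducible π)
    (hram : ¬ Irreducible (algebraMap (v.adicCompletionIntegers K) (w.adicCompletionIntegers L) ϖ))
    (σ : (w.adicCompletion L) ≃ₐ[v.adicCompletion K] (w.adicCompletion L))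
    {i : ℕ} (hi : Valued.v (σ (π : w.adicCompletion L) - π) = WithZero.exp (-(i : ℤ)))
    (e : ℕ) (he : Valued.v (2 : v.adicCompletion K) = WithZero.exp (-(e : ℤ))) (hie : i ≤ 2 * e + 1)
    {x : w.adicCompletion L} (hx : Valued.v x ≤ WithZero.exp (-((i : ℤ) - 1 + 1)))
    {u : v.adicCompletion K} (hu : algebraMap (v.adicCompletion K) (w.adicCompletion L) u = (1 + x) * σ (1 + x)) :
    Valued.v (u - 1) ≤ WithZero.exp (-((i : ℤ) - 1 + 1)) := by
  have hu1 : algebraMap (v.adicCompletion K) (w.adicCompletion L) (u - 1) = (x + σ x) + x * σ x := by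
    rw [map_sub, map_one, hu, one_add_mul_algEquiv_one_add]
    ring
  have hbound : Valued.v (algebraMap (v.adicCompletion K) (w.adicCompletion L) (u - 1)) ≤
      WithZero.exp (-(2 * ((i : ℤ) - 1) + 1)) := by
    rw [hu1]
    refine le_trans (Valuation.map_add _ _ _) (max_le ?_ ?_)
    · refine le_trans (val_add_algEquiv_le v w h2 hϖ hπ hram σ hi e he hie x _ hx) ?_
      exact WithZero.exp_le_exp.mpr (by omega)
    · rw [val_mul_algEquiv, sq]
      calc Valued.v x * Valued.v x ≤ WithZero.exp (-((i : ℤ) - 1 + 1)) * WithZero.exp (-((i : ℤ) - 1 + 1)) :=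
            mul_le_mul' hx hx
        _ = WithZero.exp (-((i : ℤ) - 1 + 1) + -((i : ℤ) - 1 + 1)) := (WithZero.exp_add _ _).symm
        _ ≤ WithZero.exp (-(2 * ((i : ℤ) - 1) + 1)) := WithZero.exp_le_exp.mpr (by omega)
  have := val_algebraMap_le_of_le_odd v w h2 hϖ hπ hram hbound
  have h' := val_le_of_val_algebraMap_le v w h2 hϖ hπ hram (n := (i : ℤ) - 1 + 1)
    (by rw [show -(2 * ((i : ℤ) - 1 + 1)) = -(2 * ((i : ℤ) - 1) + 2) by ring]; exact this)
  exact h'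


/-! ### KEY LEMMA 1: a unit whose norm lies in `U_F^{(t)}` lies in `U_E^{(t)}` -/

/-- Level `0 → 1`: `v(Y) = 1`, `N(Y) = u` with `v(u − 1) ≤ exp(−1)` ⇒ `v(Y − 1) ≤ exp(−1)` (wild: `e ≥ 1`, `i ≥ 2`). -/
theorem val_sub_one_le_exp_neg_one_of_norm (h2 : Module.finrank (v.adicCompletion K) (w.adicCompletion L) = 2)
    {ϖ : v.adicCompletionIntegers K} (hϖ : Irreducible ϖ) {π : w.adicCompletionIntegers L} (hπ : Irreducible π)
    (hram : ¬ Irreducible (algebraMap (v.adicCompletionIntegers K) (w.adicCompletionIntegers L) ϖ))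
    (σ : (w.adicCompletion L) ≃ₐ[v.adicCompletion K] (w.adicCompletion L))
    {i : ℕ} (hi : Valued.v (σ (π : w.adicCompletion L) - π) = WithZero.exp (-(i : ℤ))) (hi2 : 2 ≤ i)
    (e : ℕ) (he : Valued.v (2 : v.adicCompletion K) = WithZero.exp (-(e : ℤ))) (hie : i ≤ 2 * e + 1) (he1 : 1 ≤ e)
    {Y : w.adicCompletion L} (hY : Valued.v Y = 1) {u : v.adicCompletion K}
    (hu : algebraMap (v.adicCompletion K) (w.adicCompletion L) u = Y * σ Y)
    (hu1 : Valued.v (u - 1) ≤ WithZero.exp (-1)) :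
    Valued.v (Y - 1) ≤ WithZero.exp (-1) := by
  have hexp1 : WithZero.exp (-1 : ℤ) < 1 := by
    rw [← WithZero.exp_zero]
    exact WithZero.exp_lt_exp.mpr (by norm_num)
  obtain ⟨a, b, ha, hb, hYab⟩ :=
    exists_eq_algebraMap_add_algebraMap_mul_uniformizer_of_val_le_one v w h2 hϖ hπ hram hY.le
  have hbπ : Valued.v (algebraMap (v.adicCompletion K) (w.adicCompletion L) b * (π : w.adicCompletion L)) ≤
      WithZero.exp (-1) := by
    rw [map_mul, T5AdicCompletionNormGroup.val_uniformizer w hπ]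
    calc Valued.v (algebraMap (v.adicCompletion K) (w.adicCompletion L) b) * WithZero.exp (-1)
        ≤ 1 * WithZero.exp (-1) := by
          gcongr
          exact (T5ContinuousValuationExtension.val_algebraMap_le_one_iff b).mpr hb
      _ = WithZero.exp (-1) := one_mul _
  have hbπ1 : Valued.v (algebraMap (v.adicCompletion K) (w.adicCompletion L) b * (π : w.adicCompletion L)) < 1 :=
    lt_of_le_of_lt hbπ hexp1
  have hva : Valued.v (algebraMap (v.adicCompletion K) (w.adicCompletion L) a) = 1 := by
    have hmax := val_algebraMap_add_algebraMap_mul_uniformizer v w h2 hϖ hπ hram a b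
    rw [← hYab, hY] at hmax
    rcases max_cases (Valued.v (algebraMap (v.adicCompletion K) (w.adicCompletion L) a))
        (Valued.v (algebraMap (v.adicCompletion K) (w.adicCompletion L) b * (π : w.adicCompletion L))) with
      ⟨h, -⟩ | ⟨h, -⟩
    · rw [h] at hmax
      exact hmax.symm
    · rw [h] at hmax
      exact absurd hmax.symm hbπ1.ne
  have hva' : Valued.v a = 1 := val_eq_one_of_val_algebraMap_eq_one v w hva
  have ha0 : a ≠ 0 := by
    rintro rfl
    rw [map_zero] at hva'
    exact zero_ne_one hva'
  set x : w.adicCompletion L := algebraMap (v.adicCompletion K) (w.adicCompletion L) (b / a) * π with hx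
  have hYx : Y = algebraMap (v.adicCompletion K) (w.adicCompletion L) a * (1 + x) := by
    rw [hYab, hx, map_div₀]
    have ha0' : algebraMap (v.adicCompletion K) (w.adicCompletion L) a ≠ 0 := (map_ne_zero _).mpr ha0
    field_simp
  have hvx : Valued.v x ≤ WithZero.exp (-1) := by
    rw [hx, map_mul, map_div₀, map_div₀, hva, div_one, ← map_mul]
    exact hbπ
  set u' : v.adicCompletion K := u / a ^ 2 with hu'
  have hu'alg : algebraMap (v.adicCompletion K) (w.adicCompletion L) u' = (1 + x) * σ (1 + x) := by
    rw [hu', map_div₀, map_pow, hu, hYx, map_mul, AlgEquiv.commutes]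
    have ha0' : algebraMap (v.adicCompletion K) (w.adicCompletion L) a ≠ 0 := (map_ne_zero _).mpr ha0
    field_simp
  have hu'1 : Valued.v (u' - 1) ≤ WithZero.exp (-1) := by
    apply val_le_of_val_algebraMap_le v w h2 hϖ hπ hram (n := 1)
    rw [map_sub, map_one, hu'alg, one_add_mul_algEquiv_one_add, add_sub_cancel_left]
    refine le_trans (Valuation.map_add _ _ _) (max_le ?_ ?_)
    · refine le_trans (val_add_algEquiv_le v w h2 hϖ hπ hram σ hi e he hie x 1 hvx) ?_
      exact WithZero.exp_le_exp.mpr (by omega)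
    · rw [val_mul_algEquiv, sq]
      calc Valued.v x * Valued.v x ≤ WithZero.exp (-1) * WithZero.exp (-1) := mul_le_mul' hvx hvx
        _ = WithZero.exp (-(2 * (1 : ℤ))) := by
            rw [← WithZero.exp_add]
            congr 1
  have hu'v : Valued.v u' = 1 := by
    have hlt : Valued.v (u' - 1) < Valued.v (1 : v.adicCompletion K) := by
      rw [map_one]
      exact lt_of_le_of_lt hu'1 hexp1
    have := Valuation.map_add_eq_of_lt_right Valued.v hlt
    rwa [sub_add_cancel, map_one] at this
  have hu'0 : u' ≠ 0 := by
    intro h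
    rw [h, map_zero] at hu'v
    exact zero_ne_one hu'v
  have ha21 : Valued.v (a ^ 2 - 1) ≤ WithZero.exp (-1) := by
    have ha2u : a ^ 2 * u' = u := by
      rw [hu']
      field_simp
    have : a ^ 2 - 1 = ((u - 1) - (u' - 1)) / u' := by
      rw [eq_div_iff hu'0]
      linear_combination ha2u
    rw [this, map_div₀, hu'v, div_one]
    exact le_trans (Valuation.map_sub _ _ _) (max_le hu1 hu'1)
  have ha1le : Valued.v (a - 1) ≤ 1 := by
    refine le_trans (Valuation.map_sub _ _ _) (max_le hva'.le ?_)
    rw [map_one]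
  have ha1 : Valued.v (a - 1) ≤ WithZero.exp (-1) := by
    have hsq : Valued.v ((a - 1) ^ 2) ≤ WithZero.exp (-1) := by
      have : (a - 1) ^ 2 = (a ^ 2 - 1) - 2 * (a - 1) := by ring
      rw [this]
      refine le_trans (Valuation.map_sub _ _ _) (max_le ha21 ?_)
      rw [map_mul, he]
      calc WithZero.exp (-(e : ℤ)) * Valued.v (a - 1) ≤ WithZero.exp (-(e : ℤ)) * 1 := by gcongr
        _ ≤ WithZero.exp (-1) := by
            rw [mul_one, WithZero.exp_le_exp]
            omega
    by_cases ha1' : a - 1 = 0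
    · rw [ha1', map_zero]
      exact zero_le
    have h0 : Valued.v (a - 1) ≠ 0 := (Valuation.ne_zero_iff _).mpr ha1'
    rw [map_pow, ← WithZero.exp_log h0, ← WithZero.exp_nsmul, WithZero.exp_le_exp, nsmul_eq_mul] at hsq
    rw [← WithZero.exp_log h0, WithZero.exp_le_exp]
    push_cast at hsq
    omega
  have hfin : Y - 1 = algebraMap (v.adicCompletion K) (w.adicCompletion L) (a - 1) * (1 + x) + x := by
    rw [hYx, map_sub, map_one]
    ring
  rw [hfin]
  refine le_trans (Valuation.map_add _ _ _) (max_le ?_ hvx)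
  rw [map_mul]
  have h1x : Valued.v (1 + x) ≤ 1 := by
    refine le_trans (Valuation.map_add _ _ _) (max_le ?_ (le_trans hvx hexp1.le))
    rw [map_one]
  have ha1' : Valued.v (algebraMap (v.adicCompletion K) (w.adicCompletion L) (a - 1)) ≤ WithZero.exp (-(2 * (1 : ℤ))) :=
    val_algebraMap_le_of_val_le v w h2 hϖ hπ hram ha1
  calc Valued.v (algebraMap (v.adicCompletion K) (w.adicCompletion L) (a - 1)) * Valued.v (1 + x)
      ≤ WithZero.exp (-(2 * (1 : ℤ))) * 1 := by gcongr
    _ ≤ WithZero.exp (-1) := by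
        rw [mul_one, WithZero.exp_le_exp]
        norm_num

/-- Level `m → m + 1` (`1 ≤ m < t`): if `v(Y − 1) ≤ exp(−m)` and `N(Y) ∈ U_F^{(m+1)}` then `v(Y − 1) ≤ exp(−(m+1))`
(else `v(N(Y) − 1) = v(Y − 1)² = exp(−2m)` exactly). -/
theorem val_sub_one_le_succ_of_norm (h2 : Module.finrank (v.adicCompletion K) (w.adicCompletion L) = 2)
    {ϖ : v.adicCompletionIntegers K} (hϖ : Irreducible ϖ) {π : w.adicCompletionIntegers L} (hπ : Irreducible π)
    (hram : ¬ Irreducible (algebraMap (v.adicCompletionIntegers K) (w.adicCompletionIntegers L) ϖ))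
    (σ : (w.adicCompletion L) ≃ₐ[v.adicCompletion K] (w.adicCompletion L))
    {i : ℕ} (hi : Valued.v (σ (π : w.adicCompletion L) - π) = WithZero.exp (-(i : ℤ)))
    (e : ℕ) (he : Valued.v (2 : v.adicCompletion K) = WithZero.exp (-(e : ℤ))) (hie : i ≤ 2 * e + 1)
    {m : ℕ} (hmi : m + 1 < i)
    {Y : w.adicCompletion L} (hY : Valued.v (Y - 1) ≤ WithZero.exp (-(m : ℤ))) {u : v.adicCompletion K}
    (hu : algebraMap (v.adicCompletion K) (w.adicCompletion L) u = Y * σ Y)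
    (hum : Valued.v (u - 1) ≤ WithZero.exp (-((m : ℤ) + 1))) :
    Valued.v (Y - 1) ≤ WithZero.exp (-((m : ℤ) + 1)) := by
  by_contra hcon
  set x : w.adicCompletion L := Y - 1 with hx
  have hx0 : x ≠ 0 := by
    intro h
    apply hcon
    rw [h, map_zero]
    exact zero_le
  have h0 : Valued.v x ≠ 0 := (Valuation.ne_zero_iff _).mpr hx0
  have hvx : Valued.v x = WithZero.exp (-(m : ℤ)) := by
    rw [← WithZero.exp_log h0] at hY hcon ⊢
    rw [WithZero.exp_le_exp] at hY hcon
    congr 1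
    omega
  have hu1 : algebraMap (v.adicCompletion K) (w.adicCompletion L) (u - 1) = (x + σ x) + x * σ x := by
    have hYx : Y = 1 + x := by
      rw [hx]
      ring
    rw [map_sub, map_one, hu, hYx, one_add_mul_algEquiv_one_add]
    ring
  have hN : Valued.v (x * σ x) = WithZero.exp (-(2 * (m : ℤ))) := by
    rw [val_mul_algEquiv, hvx, ← WithZero.exp_nsmul]
    congr 1
    rw [nsmul_eq_mul]
    push_cast
    ring
  have hT : Valued.v (x + σ x) < Valued.v (x * σ x) := by
    rw [hN]
    refine lt_of_le_of_lt (val_add_algEquiv_le v w h2 hϖ hπ hram σ hi e he hie x m hvx.le) ?_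
    rw [WithZero.exp_lt_exp]
    omega
  have hval : Valued.v (algebraMap (v.adicCompletion K) (w.adicCompletion L) (u - 1)) =
      WithZero.exp (-(2 * (m : ℤ))) := by
    rw [hu1, Valuation.map_add_eq_of_lt_right _ hT, hN]
  have hle := val_algebraMap_le_of_val_le v w h2 hϖ hπ hram (n := (m : ℤ) + 1) hum
  rw [hval, WithZero.exp_le_exp] at hle
  omega

/-- KEY LEMMA 1: `v(Y) = 1` and `N(Y) = u` with `v(u − 1) ≤ exp(−t)` (`t = i − 1 ≥ 1`) ⇒ `v(Y − 1) ≤ exp(−t)`. -/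
theorem val_sub_one_le_of_norm (h2 : Module.finrank (v.adicCompletion K) (w.adicCompletion L) = 2)
    {ϖ : v.adicCompletionIntegers K} (hϖ : Irreducible ϖ) {π : w.adicCompletionIntegers L} (hπ : Irreducible π)
    (hram : ¬ Irreducible (algebraMap (v.adicCompletionIntegers K) (w.adicCompletionIntegers L) ϖ))
    (σ : (w.adicCompletion L) ≃ₐ[v.adicCompletion K] (w.adicCompletion L))
    {i : ℕ} (hi : Valued.v (σ (π : w.adicCompletion L) - π) = WithZero.exp (-(i : ℤ)))
    (e : ℕ) (he : Valued.v (2 : v.adicCompletion K) = WithZero.exp (-(e : ℤ))) (hie : i ≤ 2 * e + 1) (he1 : 1 ≤ e)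
    {t : ℕ} (hti : i = t + 1) (ht1 : 1 ≤ t)
    {Y : w.adicCompletion L} (hY : Valued.v Y = 1) {u : v.adicCompletion K}
    (hu : algebraMap (v.adicCompletion K) (w.adicCompletion L) u = Y * σ Y)
    (hut : Valued.v (u - 1) ≤ WithZero.exp (-(t : ℤ))) :
    Valued.v (Y - 1) ≤ WithZero.exp (-(t : ℤ)) := by
  have key : ∀ m : ℕ, m ≤ t → Valued.v (Y - 1) ≤ WithZero.exp (-(m : ℤ)) := by
    intro m
    induction m with
    | zero =>
      intro _
      refine le_trans (Valuation.map_sub _ _ _) (max_le ?_ ?_)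
      · rw [hY]
        simp
      · rw [map_one]
        simp
    | succ m ih =>
      intro hm
      have hYm := ih (by omega)
      have hum : Valued.v (u - 1) ≤ WithZero.exp (-((m : ℤ) + 1)) :=
        le_trans hut (WithZero.exp_le_exp.mpr (by omega))
      rcases Nat.eq_zero_or_pos m with rfl | hmpos
      · have := val_sub_one_le_exp_neg_one_of_norm v w h2 hϖ hπ hram σ hi (by omega) e he hie he1 hY hu
          (by simpa using hum)
        simpa using this
      · have := val_sub_one_le_succ_of_norm v w h2 hϖ hπ hram σ hi e he hie (m := m) (by omega) hYm hu hum
        push_cast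
        exact this
  have := key t le_rfl
  exact this

end Estimates

end

end Summit.Ventures.HodgeRepro2.T5RamifiedNormEstimates
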